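import Summits.RiemannHypothesis.RiemannHypothesis.Theorems.DBNStripKernelSymbol
import Summits.RiemannHypothesis.RiemannHypothesis.Theorems.DBNCauchyFourier
import Summits.RiemannHypothesis.RiemannHypothesis.Theorems.DBNProbeFactorisation
import Mathlib.Analysis.Fourier.Convolution
import Literature.Analysis.Complex.DeBruijnUniversalFactorsProofs
import HarnessLib

/-!
# RiemannHypothesis / DBN — the strip kernel as a Fourier multiplier

RH-FREE support lemmas for the `pub-dbn` cell's Sketch4 targets F1/F1′ (THEORY-R4 §2,
`Sketch4.lean` sha16 3a8b9a024097398f; proved in `Theorems/DBNStripRepresentation.lean`).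
With `Q^{(η)} = stripKernel η` (`Theorems/DBNStripCorrector.lean`) and Mathlib's normalisation of `𝓕`:

* `fourier_stripKernel` — `𝓕 Q^{(η)} (w) = cosh(2πηw)/cosh(2πw)` (`|η| < 1`): `StripKernelSymbol`
  (`Theorems/DBNStripKernelSymbol.lean`) at `k = 2πw` plus evenness of `Q^{(η)}`;
* `stripKernel_eq_fourierInv` — Fourier inversion `Q^{(η)} = 𝓕⁻[cosh(2πηw)/cosh(2πw)]`
  (`Continuous.fourierInv_fourier_eq`; the multiplier is `O(e^{−2π(1−|η|)|w|})`, using de Bruijn 1950's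
  `cosh x ≤ e^{|x|}` from `Literature.Analysis.Complex.DeBruijnUniversalFactorsProofs`);
* `cauchy_conv_stripKernel_eq_fourierInv` — `(cauchy_a ⋆ Q^{(η)}) = 𝓕⁻[π e^{−2πa|w|}·cosh(2πηw)/cosh(2πw)]`
  by Mathlib's convolution theorem (`Real.fourier_mul_convolution_eq`) and inversion;
* `stripMultiplier_identity` — `(1 + e^{−4π|v|}) cosh(2πηv)/cosh(2πv) = (e^{2πηv}+e^{−2πηv}) e^{−2π|v|}`,
  the one-line reason why Poisson-smoothing the boundary data reproduces the interior kernels.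

Pure harmonic analysis of the kernels; nothing here bears on the truth of RH.
`--supports stmt-RiemannHypothesis-0274`.
-/

noncomputable section

-- D-0017: `Summit.<S>.<S>.…` is the designed namespace of a single-problem summit.
set_option linter.dupNamespace false

open scoped Real FourierTransform Convolution
open MeasureTheory Set Filter Complex Literature.Analysis.Complex

namespace Summit.RiemannHypothesis.RiemannHypothesis.Theorems.DbnTheory

/-! ## The strip kernel: evenness, continuity, integrability, Fourier transform -/

/-- `Q^{(η)}` is even. [folklore] -/
theorem stripKernel_neg (η x : ℝ) : stripKernel η (-x) = stripKernel η x := by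
  unfold stripKernel
  rw [show π * -x / 2 = -(π * x / 2) by ring, Real.cosh_neg]

/-- The denominator of `Q^{(η)}` is positive for `|η| < 1`. [folklore] -/
theorem stripKernel_den_pos {η : ℝ} (hη : |η| < 1) (x : ℝ) :
    0 < Real.cosh (π * x / 2) ^ 2 - Real.sin (π * η / 2) ^ 2 := by
  obtain ⟨h1, h2⟩ := abs_lt.mp hη
  have hcos : 0 < Real.cos (π * η / 2) := by
    apply Real.cos_pos_of_mem_Ioo; constructor <;> nlinarith [Real.pi_pos]
  have hc := Real.sin_sq_add_cos_sq (π * η / 2)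
  have h1c : 1 ≤ Real.cosh (π * x / 2) := Real.one_le_cosh _
  nlinarith [sq_nonneg (Real.cos (π * η / 2))]

/-- `Q^{(η)}` is continuous (`|η| < 1`). [folklore] -/
theorem continuous_stripKernel {η : ℝ} (hη : |η| < 1) : Continuous (stripKernel η) := by
  have h : Continuous fun x : ℝ => (1/2) * Real.cos (π * η / 2) * Real.cosh (π * x / 2) /
      (Real.cosh (π * x / 2) ^ 2 - Real.sin (π * η / 2) ^ 2) :=
    Continuous.div (by fun_prop) (by fun_prop) (fun x => (stripKernel_den_pos hη x).ne')
  exact h.congr (fun x => by unfold stripKernel; rfl)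

/-- `Q^{(η)}` is nonnegative (`|η| < 1`). [folklore] -/
theorem stripKernel_nonneg {η : ℝ} (hη : |η| < 1) (x : ℝ) : 0 ≤ stripKernel η x := by
  obtain ⟨h1, h2⟩ := abs_lt.mp hη
  have hcos : 0 < Real.cos (π * η / 2) := by
    apply Real.cos_pos_of_mem_Ioo; constructor <;> nlinarith [Real.pi_pos]
  unfold stripKernel
  have := stripKernel_den_pos hη x
  have := Real.cosh_pos (π * x / 2)
  positivity

/-- `Q^{(η)}` is integrable (`|η| < 1`). [folklore] -/
theorem integrable_stripKernel {η : ℝ} (hη : |η| < 1) : Integrable (stripKernel η) := by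
  have h := integrable_exp_mul_inv_cosh hη 0
  have hH : Integrable fun x : ℝ =>
      (Complex.cosh (((π * x / 2 : ℝ) : ℂ) + ((π * η / 2 : ℝ) : ℂ) * I))⁻¹ := by
    refine h.congr (Eventually.of_forall fun x => ?_)
    simp
  have h2 := (Complex.reCLM.integrable_comp hH).const_mul (1 / 2 : ℝ)
  refine h2.congr (Eventually.of_forall fun x => ?_)
  show (1 / 2 : ℝ) * Complex.reCLM _ = stripKernel η x
  rw [Complex.reCLM_apply, re_inv_cosh_eq_two_mul_stripKernel]
  ring

/-- The sine transform of the even kernel `Q^{(η)}` vanishes. [folklore] -/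
theorem integral_stripKernel_mul_sin (η c : ℝ) : ∫ v : ℝ, stripKernel η v * Real.sin (c * v) = 0 := by
  have h := integral_neg_eq_self (fun v : ℝ => stripKernel η v * Real.sin (c * v)) volume
  simp only [stripKernel_neg, mul_neg, Real.sin_neg, integral_neg] at h
  linarith

/-- **Fourier transform of the strip kernel** (Mathlib normalisation):
`𝓕 Q^{(η)} (w) = cosh(2πηw)/cosh(2πw)` — `StripKernelSymbol` at `k = 2πw` plus evenness. [folklore] -/
theorem fourier_stripKernel {η : ℝ} (hη : |η| < 1) (w : ℝ) :
    𝓕 (fun x : ℝ => (stripKernel η x : ℂ)) w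
      = ((Real.cosh (2 * π * η * w) / Real.cosh (2 * π * w) : ℝ) : ℂ) := by
  rw [Real.fourier_real_eq_integral_exp_smul]
  have hsks := StripKernelSymbol_holds η (2 * π * w) hη
  have hQ := integrable_stripKernel hη
  have hcos : Integrable fun v : ℝ => stripKernel η v * Real.cos (2 * π * w * v) :=
    hQ.mul_bdd (c := 1) (by fun_prop : Continuous fun v : ℝ => Real.cos (2 * π * w * v)).aestronglyMeasurable
      (Eventually.of_forall fun v => by rw [Real.norm_eq_abs]; exact Real.abs_cos_le_one _)
  have hsin : Integrable fun v : ℝ => stripKernel η v * Real.sin (-(2 * π * w) * v) :=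
    hQ.mul_bdd (c := 1) (by fun_prop : Continuous fun v : ℝ => Real.sin (-(2 * π * w) * v)).aestronglyMeasurable
      (Eventually.of_forall fun v => by rw [Real.norm_eq_abs]; exact Real.abs_sin_le_one _)
  have hdecomp : ∀ v : ℝ, Complex.exp (↑(-2 * π * v * w) * I) • ((stripKernel η v : ℝ) : ℂ)
      = ((stripKernel η v * Real.cos (2 * π * w * v) : ℝ) : ℂ)
        + ((stripKernel η v * Real.sin (-(2 * π * w) * v) : ℝ) : ℂ) * I := by
    intro v
    rw [smul_eq_mul, Complex.exp_mul_I, ← Complex.ofReal_cos, ← Complex.ofReal_sin]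
    have hc : Real.cos (-2 * π * v * w) = Real.cos (2 * π * w * v) := by
      rw [show -2 * π * v * w = -(2 * π * w * v) by ring, Real.cos_neg]
    have hs : Real.sin (-2 * π * v * w) = Real.sin (-(2 * π * w) * v) := by
      congr 1; ring
    rw [hc, hs]
    push_cast
    ring
  have hcosC : Integrable fun v : ℝ => ((stripKernel η v * Real.cos (2 * π * w * v) : ℝ) : ℂ) := hcos.ofReal
  have hsinC : Integrable fun v : ℝ => ((stripKernel η v * Real.sin (-(2 * π * w) * v) : ℝ) : ℂ) * I :=
    hsin.ofReal.mul_const I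
  simp_rw [hdecomp]
  rw [integral_add hcosC hsinC, integral_mul_const, integral_complex_ofReal, integral_complex_ofReal, hsks,
    integral_stripKernel_mul_sin]
  push_cast
  ring_nf

/-- The multiplier `cosh(2πηw)/cosh(2πw)` is at most `2e^{−2π(1−|η|)|w|}`. [folklore] -/
theorem stripMultiplier_le {η : ℝ} (w : ℝ) :
    Real.cosh (2 * π * η * w) / Real.cosh (2 * π * w) ≤ 2 * Real.exp (-(2 * π * (1 - |η|)) * |w|) := by
  have hc : 0 < Real.cosh (2 * π * w) := Real.cosh_pos _
  rw [div_le_iff₀ hc]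
  have h1 : Real.cosh (2 * π * η * w) ≤ Real.exp (2 * π * |η| * |w|) := by
    have := Literature.Analysis.Complex.DeBruijn1950.cosh_le_exp_abs (2 * π * η * w)
    rwa [show |2 * π * η * w| = 2 * π * |η| * |w| by
      rw [abs_mul, abs_mul, abs_mul, abs_two, abs_of_pos Real.pi_pos]] at this
  have h2 : Real.exp |2 * π * w| / 2 ≤ Real.cosh (2 * π * w) := exp_abs_div_two_le_cosh _
  rw [show |2 * π * w| = 2 * π * |w| by rw [abs_mul, abs_mul, abs_two, abs_of_pos Real.pi_pos]] at h2
  have h3 : Real.exp (2 * π * |η| * |w|) = 2 * Real.exp (-(2 * π * (1 - |η|)) * |w|) * (Real.exp (2 * π * |w|) / 2) := by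
    rw [show 2 * Real.exp (-(2 * π * (1 - |η|)) * |w|) * (Real.exp (2 * π * |w|) / 2)
      = Real.exp (-(2 * π * (1 - |η|)) * |w|) * Real.exp (2 * π * |w|) by ring, ← Real.exp_add]
    congr 1; ring
  calc Real.cosh (2 * π * η * w) ≤ Real.exp (2 * π * |η| * |w|) := h1
    _ = 2 * Real.exp (-(2 * π * (1 - |η|)) * |w|) * (Real.exp (2 * π * |w|) / 2) := h3
    _ ≤ 2 * Real.exp (-(2 * π * (1 - |η|)) * |w|) * Real.cosh (2 * π * w) := by gcongr

/-- The multiplier `cosh(2πηw)/cosh(2πw)` is nonnegative and at most `1` (`|η| < 1`). [folklore] -/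
theorem stripMultiplier_nonneg (η w : ℝ) : 0 ≤ Real.cosh (2 * π * η * w) / Real.cosh (2 * π * w) :=
  div_nonneg (Real.cosh_pos _).le (Real.cosh_pos _).le

/-- Continuity of the multiplier. [folklore] -/
theorem continuous_stripMultiplierC (η : ℝ) :
    Continuous fun w : ℝ => ((Real.cosh (2 * π * η * w) / Real.cosh (2 * π * w) : ℝ) : ℂ) :=
  continuous_ofReal.comp (Continuous.div (by fun_prop) (by fun_prop) fun w => (Real.cosh_pos _).ne')

/-- Integrability of the multiplier (`|η| < 1`), real form. [folklore] -/
theorem integrable_stripMultiplier {η : ℝ} (hη : |η| < 1) :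
    Integrable fun w : ℝ => Real.cosh (2 * π * η * w) / Real.cosh (2 * π * w) := by
  have hb : 0 < 2 * π * (1 - |η|) := by nlinarith [Real.pi_pos, abs_nonneg η]
  refine ((integrable_exp_neg_mul_abs hb).const_mul 2).mono'
    (Continuous.div (by fun_prop) (by fun_prop) fun w => (Real.cosh_pos _).ne').aestronglyMeasurable
    (Eventually.of_forall fun w => ?_)
  rw [Real.norm_of_nonneg (stripMultiplier_nonneg η w)]
  exact stripMultiplier_le w

/-- Integrability of the multiplier (`|η| < 1`), complex form. [folklore] -/
theorem integrable_stripMultiplierC {η : ℝ} (hη : |η| < 1) :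
    Integrable fun w : ℝ => ((Real.cosh (2 * π * η * w) / Real.cosh (2 * π * w) : ℝ) : ℂ) :=
  (integrable_stripMultiplier hη).ofReal

/-- **Fourier inversion for the strip kernel**: `Q^{(η)}(x) = ∫ e^{2πiwx} cosh(2πηw)/cosh(2πw) dw`. [folklore] -/
theorem stripKernel_eq_fourierInv {η : ℝ} (hη : |η| < 1) (x : ℝ) :
    ((stripKernel η x : ℝ) : ℂ)
      = 𝓕⁻ (fun w : ℝ => ((Real.cosh (2 * π * η * w) / Real.cosh (2 * π * w) : ℝ) : ℂ)) x := by
  have hF : 𝓕 (fun x : ℝ => (stripKernel η x : ℂ))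
      = fun w => ((Real.cosh (2 * π * η * w) / Real.cosh (2 * π * w) : ℝ) : ℂ) :=
    funext (fourier_stripKernel hη)
  have hcont : Continuous fun x : ℝ => (stripKernel η x : ℂ) :=
    continuous_ofReal.comp (continuous_stripKernel hη)
  have hint : Integrable fun x : ℝ => (stripKernel η x : ℂ) := (integrable_stripKernel hη).ofReal
  have hinv := hcont.fourierInv_fourier_eq hint (by rw [hF]; exact integrable_stripMultiplierC hη)
  rw [hF] at hinv
  exact (congrFun hinv x).symm

/-! ## Poisson smoothing of the strip kernel: `cauchy_a ⋆ Q^{(η)}` by Fourier inversion -/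

/-- Integrability of `π e^{−2πa|w|} · cosh(2πηw)/cosh(2πw)` (`a ≥ 0`, `|η| < 1`). [folklore] -/
theorem integrable_expKernel_mul_stripMultiplierC {η : ℝ} (hη : |η| < 1) {a : ℝ} (ha : 0 ≤ a) :
    Integrable fun w : ℝ => ((π * Real.exp (-(2 * π * a * |w|)) : ℝ) : ℂ) *
      ((Real.cosh (2 * π * η * w) / Real.cosh (2 * π * w) : ℝ) : ℂ) := by
  refine ((integrable_stripMultiplier hη).const_mul π).mono'
    ((continuous_pi_mul_exp_neg a).mul (continuous_stripMultiplierC η)).aestronglyMeasurable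
    (Eventually.of_forall fun w => ?_)
  rw [norm_mul, Complex.norm_real, Complex.norm_real,
    Real.norm_of_nonneg (by positivity), Real.norm_of_nonneg (stripMultiplier_nonneg η w)]
  have h1 : Real.exp (-(2 * π * a * |w|)) ≤ 1 := by
    rw [Real.exp_le_one_iff]
    have : 0 ≤ 2 * π * a * |w| := by positivity
    linarith
  have h2 := stripMultiplier_nonneg η w
  nlinarith [mul_nonneg (mul_nonneg Real.pi_pos.le h2) (sub_nonneg.mpr h1)]


/-- `𝓕[cauchy a] = π e^{−2πa|w|}` in the tree's vocabulary `cauchy a s = a/(s²+a²)`. [folklore] -/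
theorem fourier_cauchy (a : ℝ) (ha : 0 < a) :
    𝓕 (fun s : ℝ => ((cauchy a s : ℝ) : ℂ)) = fun w : ℝ => ((π * Real.exp (-(2 * π * a * |w|)) : ℝ) : ℂ) :=
  fourier_cauchyC a ha

/-- **`(cauchy_a ⋆ Q^{(η)})(x) = ∫ e^{2πiwx} π e^{−2πa|w|} cosh(2πηw)/cosh(2πw) dw`** (`a > 0`, `|η| < 1`):
convolution theorem plus Fourier inversion. [folklore] -/
theorem cauchy_conv_stripKernel_eq_fourierInv {η : ℝ} (hη : |η| < 1) {a : ℝ} (ha : 0 < a) (x : ℝ) :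
    ((fun s : ℝ => ((cauchy a s : ℝ) : ℂ)) ⋆[ContinuousLinearMap.mul ℂ ℂ]
        (fun s : ℝ => ((stripKernel η s : ℝ) : ℂ))) x
      = 𝓕⁻ (fun w : ℝ => ((π * Real.exp (-(2 * π * a * |w|)) : ℝ) : ℂ) *
          ((Real.cosh (2 * π * η * w) / Real.cosh (2 * π * w) : ℝ) : ℂ)) x := by
  have hf1 : Integrable fun s : ℝ => ((cauchy a s : ℝ) : ℂ) := (integrable_cauchy ha).ofReal
  have hf2 : Integrable fun s : ℝ => ((stripKernel η s : ℝ) : ℂ) := (integrable_stripKernel hη).ofReal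
  have hFf : 𝓕 ((fun s : ℝ => ((cauchy a s : ℝ) : ℂ)) ⋆[ContinuousLinearMap.mul ℂ ℂ]
        (fun s : ℝ => ((stripKernel η s : ℝ) : ℂ)))
      = fun w : ℝ => ((π * Real.exp (-(2 * π * a * |w|)) : ℝ) : ℂ) *
          ((Real.cosh (2 * π * η * w) / Real.cosh (2 * π * w) : ℝ) : ℂ) := by
    funext w
    rw [Real.fourier_mul_convolution_eq hf1 hf2 w, fourier_cauchy a ha, fourier_stripKernel hη w]
  have hbdd : BddAbove (range fun s : ℝ => ‖((cauchy a s : ℝ) : ℂ)‖) := by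
    refine ⟨a⁻¹, ?_⟩
    rintro _ ⟨s, rfl⟩
    dsimp only
    rw [Complex.norm_real, Real.norm_of_nonneg (cauchy_nonneg ha s)]
    exact cauchy_le_inv ha s
  have hcont : Continuous ((fun s : ℝ => ((cauchy a s : ℝ) : ℂ)) ⋆[ContinuousLinearMap.mul ℂ ℂ]
        (fun s : ℝ => ((stripKernel η s : ℝ) : ℂ))) :=
    hbdd.continuous_convolution_left_of_integrable (ContinuousLinearMap.mul ℂ ℂ)
      (continuous_ofReal.comp (continuous_cauchy ha)) hf2
  have hint : Integrable ((fun s : ℝ => ((cauchy a s : ℝ) : ℂ)) ⋆[ContinuousLinearMap.mul ℂ ℂ]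
        (fun s : ℝ => ((stripKernel η s : ℝ) : ℂ))) :=
    hf1.integrable_convolution (ContinuousLinearMap.mul ℂ ℂ) hf2
  have hintF : Integrable (𝓕 ((fun s : ℝ => ((cauchy a s : ℝ) : ℂ)) ⋆[ContinuousLinearMap.mul ℂ ℂ]
        (fun s : ℝ => ((stripKernel η s : ℝ) : ℂ)))) := by
    rw [hFf]
    exact integrable_expKernel_mul_stripMultiplierC hη ha.le
  have hinv := hcont.fourierInv_fourier_eq hint hintF
  rw [hFf] at hinv
  exact (congrFun hinv x).symm

/-- The multiplier identity behind F1/F1′: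
`(1 + e^{−4π|v|}) cosh(2πηv)/cosh(2πv) = (e^{2πηv} + e^{−2πηv}) e^{−2π|v|}`. [folklore] -/
theorem stripMultiplier_identity (η v : ℝ) :
    (1 + Real.exp (-(4 * π * |v|))) * (Real.cosh (2 * π * η * v) / Real.cosh (2 * π * v))
      = (Real.exp (2 * π * η * v) + Real.exp (-(2 * π * η * v))) * Real.exp (-(2 * π * |v|)) := by
  have hcy : Real.cosh (2 * π * v) = (Real.exp (2 * π * |v|) + Real.exp (-(2 * π * |v|))) / 2 := by
    rw [← Real.cosh_abs, show |2 * π * v| = 2 * π * |v| by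
      rw [abs_mul, abs_mul, abs_two, abs_of_pos Real.pi_pos], Real.cosh_eq]
  have hca : Real.cosh (2 * π * η * v) = (Real.exp (2 * π * η * v) + Real.exp (-(2 * π * η * v))) / 2 :=
    Real.cosh_eq _
  have h1 : Real.exp (-(2 * π * |v|)) * Real.exp (2 * π * |v|) = 1 := by
    rw [← Real.exp_add]; simp
  have h2 : Real.exp (-(4 * π * |v|)) = Real.exp (-(2 * π * |v|)) * Real.exp (-(2 * π * |v|)) := by
    rw [← Real.exp_add]; congr 1; ring
  have hpos : 0 < (Real.exp (2 * π * |v|) + Real.exp (-(2 * π * |v|))) / 2 := by positivity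
  have key : (1 + Real.exp (-(4 * π * |v|))) / Real.cosh (2 * π * v) = 2 * Real.exp (-(2 * π * |v|)) := by
    rw [hcy, div_eq_iff hpos.ne', h2]
    linear_combination -h1
  calc (1 + Real.exp (-(4 * π * |v|))) * (Real.cosh (2 * π * η * v) / Real.cosh (2 * π * v))
      = Real.cosh (2 * π * η * v) * ((1 + Real.exp (-(4 * π * |v|))) / Real.cosh (2 * π * v)) := by ring
    _ = Real.cosh (2 * π * η * v) * (2 * Real.exp (-(2 * π * |v|))) := by rw [key]
    _ = _ := by rw [hca]; ring


end Summit.RiemannHypothesis.RiemannHypothesis.Theorems.DbnTheory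

end
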